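import Summits.HodgeConjecture.HodgeCM.Model.Binders.Real34Meeting_1

/-! PORT of `HodgeCM/Model/Binders/Real34Meeting.lean` (HodgeCMPerL run 82) — part 2: continuation of `Summits.HodgeConjecture.HodgeCM.Model.Binders.Real34Meeting_1` (split at a top-level declaration boundary by port_pkg.py; scope re-opened below; declarations unchanged). -/

-- port_pkg: scope re-opened for this part (file-level context, then the namespace/section stack open at the cut)
set_option autoImplicit false
noncomputable section
open scoped InnerProductSpace
open MeasureTheory MulAction Set Filter
open Literature.MeasureTheory.Group
open Literature.NumberTheory.Automorphic Literature.NumberTheory.Automorphic.UnitaryGroup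
open Literature.NumberTheory.Automorphic.LevelOrbit
open NumberField
namespace HodgeCM
namespace Model
variable {L : CMField} {ι₁ : L →+* ℂ} (V : HermSpace3 L ι₁) (hV : IsAnisotropic L V.Hm)
set_option maxHeartbeats 800000 in
/-- **THE MEETING STEP of (L-loc)** (row `real34`, clause `meet`; Getz–Hahn (6.8) at the principal piece of `[U(V)]`).
Data: the finite level `K₁` of the (12)-side (compact open), the finite level `K'` at which the two (34)-representatives `G₃, G₄` are
saturated (open; saturation read on `U(V)(𝔸)`: right-invariance of `Gᵢ ∘ e` under `awayFromCM ⊓ M_{K'}`), a continuous function `f` on the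
principal arithmetic quotient `Λ_{K₁} \ U(V)(L ⊗ ℝ)` (for (L-loc): the principal lift of the top form of `ω₁ ∪ ω₂`, so that
`Λ_{Γ₁}(ω₁, ω₂) = pieceEmb f`, `EmbInstance.embOf_apply`).  If `⟪pieceEmb_{M_{K₁}} f, realise (G₃ ∧ G₄)⟫ ≠ 0` then for some `k_f ∈ K₁`:
the class at level `M_{K₁ ∩ k_f⁻¹ K' k_f}` lifted, through the SAME principal piece, from the pull-back `f ∘ levelCover` pairs non-trivially
with the realised wedge of the translates `G₃(· e(1, k_f⁻¹))`, `G₄(· e(1, k_f⁻¹))`, and both translates are saturated at `K₁ ∩ k_f⁻¹ K' k_f`.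
The compactness instances are stated as the tree states them (supplied by the consumer from
`compactSpace_arch_quotient_cmPrincipalLattice_of_anisotropic` / `compactSpace_quotient_pieceLattice`). -/
theorem exists_inner_pieceEmb_rTranslate₂_ne_zero
    (K₁ K' : Subgroup (finAdelic (↥(maximalRealSubfield L)) L (IsCMField.complexConj L) 3 V.Hm))
    (hK₁c : IsCompact (K₁ : Set (finAdelic (↥(maximalRealSubfield L)) L (IsCMField.complexConj L) 3 V.Hm)))
    (hK₁o : IsOpen (K₁ : Set (finAdelic (↥(maximalRealSubfield L)) L (IsCMField.complexConj L) 3 V.Hm)))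
    (hK'o : IsOpen (K' : Set (finAdelic (↥(maximalRealSubfield L)) L (IsCMField.complexConj L) 3 V.Hm)))
    [CompactSpace (arch (↥(maximalRealSubfield L)) L (IsCMField.complexConj L) 3 V.Hm ⧸
      pieceLattice (cmSplitLevel (L : Type) 3 V.Hm K₁) (adelicUnitaryRat (L : Type) V.Hm) (cmSplitProj (L : Type) 3 V.Hm K₁)
        (cmPrincipalPoint (L : Type) 3 V.Hm))]
    [hK : ∀ k : K₁, CompactSpace (arch (↥(maximalRealSubfield L)) L (IsCMField.complexConj L) 3 V.Hm ⧸
      pieceLattice (cmSplitLevel (L : Type) 3 V.Hm (K₁ ⊓ conjLevel K' (k : finAdelic (↥(maximalRealSubfield L)) L (IsCMField.complexConj L) 3 V.Hm)⁻¹))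
        (adelicUnitaryRat (L : Type) V.Hm)
        ((cmSplitProj (L : Type) 3 V.Hm K₁).comp (Subgroup.inclusion
          (splitLevel_mono (cmAdelicProdEquiv (L : Type) 3 V.Hm).toMulEquiv
            (inf_le_left : K₁ ⊓ conjLevel K' (k : finAdelic (↥(maximalRealSubfield L)) L (IsCMField.complexConj L) 3 V.Hm)⁻¹ ≤ K₁))))
        (cmPrincipalPoint (L : Type) 3 V.Hm))]
    (f : C(arch (↥(maximalRealSubfield L)) L (IsCMField.complexConj L) 3 V.Hm ⧸
      pieceLattice (cmSplitLevel (L : Type) 3 V.Hm K₁) (adelicUnitaryRat (L : Type) V.Hm) (cmSplitProj (L : Type) 3 V.Hm K₁)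
        (cmPrincipalPoint (L : Type) 3 V.Hm), ℂ))
    (G₃ G₄ : (quotU V).leftInvCont₂)
    (h₃ : ∀ g₀ : ↥(Literature.NumberTheory.Automorphic.adelicUnitaryGroup (L : Type) V.Hm), ∀ m₀ ∈ satLevelOf V K',
      (G₃ : (quotU V).G → (Fin 2 → ℂ)) (regimeEquivT V hV (g₀ * m₀)) =
        (G₃ : (quotU V).G → (Fin 2 → ℂ)) (regimeEquivT V hV g₀))
    (h₄ : ∀ g₀ : ↥(Literature.NumberTheory.Automorphic.adelicUnitaryGroup (L : Type) V.Hm), ∀ m₀ ∈ satLevelOf V K',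
      (G₄ : (quotU V).G → (Fin 2 → ℂ)) (regimeEquivT V hV (g₀ * m₀)) =
        (G₄ : (quotU V).G → (Fin 2 → ℂ)) (regimeEquivT V hV g₀))
    (hne : ⟪(quotU V).pieceEmb (adelicUnitaryRat (L : Type) V.Hm) (regimeEquivT V hV)
          (regimeEquivT_mem_Γ_iff V hV)
          (cmSplitLevel (L : Type) 3 V.Hm K₁) (cmSplitProj (L : Type) 3 V.Hm K₁) (cmPrincipalPoint (L : Type) 3 V.Hm)
          (isOpen_cmSplitLevel (L : Type) 3 V.Hm K₁ hK₁o) (continuous_cmSplitProj (L : Type) 3 V.Hm K₁) f,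
        (quotU V).realise ((quotU V).wedge₂ G₃ G₄)⟫_ℂ ≠ 0) :
    ∃ k : K₁,
      ⟪(quotU V).pieceEmb (adelicUnitaryRat (L : Type) V.Hm) (regimeEquivT V hV)
            (regimeEquivT_mem_Γ_iff V hV)
            (cmSplitLevel (L : Type) 3 V.Hm (K₁ ⊓ conjLevel K' (k : finAdelic (↥(maximalRealSubfield L)) L (IsCMField.complexConj L) 3 V.Hm)⁻¹))
            ((cmSplitProj (L : Type) 3 V.Hm K₁).comp (Subgroup.inclusion
              (splitLevel_mono (cmAdelicProdEquiv (L : Type) 3 V.Hm).toMulEquiv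
                (inf_le_left : K₁ ⊓ conjLevel K' (k : finAdelic (↥(maximalRealSubfield L)) L (IsCMField.complexConj L) 3 V.Hm)⁻¹ ≤ K₁))))
            (cmPrincipalPoint (L : Type) 3 V.Hm)
            (isOpen_cmSplitLevel (L : Type) 3 V.Hm _ (isOpen_coe_subgroup_inf hK₁o (isOpen_conjLevel K' hK'o _)))
            ((continuous_cmSplitProj (L : Type) 3 V.Hm K₁).comp (continuous_inclusion
              (splitLevel_mono (cmAdelicProdEquiv (L : Type) 3 V.Hm).toMulEquiv
                (inf_le_left : K₁ ⊓ conjLevel K' (k : finAdelic (↥(maximalRealSubfield L)) L (IsCMField.complexConj L) 3 V.Hm)⁻¹ ≤ K₁))))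
            (f.comp (levelCoverCM (cmSplitLevel (L : Type) 3 V.Hm K₁) (adelicUnitaryRat (L : Type) V.Hm) (cmSplitProj (L : Type) 3 V.Hm K₁)
              (cmPrincipalPoint (L : Type) 3 V.Hm)
              (cmSplitLevel (L : Type) 3 V.Hm (K₁ ⊓ conjLevel K' (k : finAdelic (↥(maximalRealSubfield L)) L (IsCMField.complexConj L) 3 V.Hm)⁻¹))
              (splitLevel_mono (cmAdelicProdEquiv (L : Type) 3 V.Hm).toMulEquiv
                (inf_le_left : K₁ ⊓ conjLevel K' (k : finAdelic (↥(maximalRealSubfield L)) L (IsCMField.complexConj L) 3 V.Hm)⁻¹ ≤ K₁)))),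
          (quotU V).realise ((quotU V).wedge₂
            ((quotU V).rTranslate₂ G₃ (regimeEquivT V hV
              ((cmAdelicProdEquiv (L : Type) 3 V.Hm).symm (1, (k : finAdelic (↥(maximalRealSubfield L)) L (IsCMField.complexConj L) 3 V.Hm)⁻¹))))
            ((quotU V).rTranslate₂ G₄ (regimeEquivT V hV
              ((cmAdelicProdEquiv (L : Type) 3 V.Hm).symm (1, (k : finAdelic (↥(maximalRealSubfield L)) L (IsCMField.complexConj L) 3 V.Hm)⁻¹)))))⟫_ℂ ≠ 0 ∧
      (∀ g₀ : ↥(Literature.NumberTheory.Automorphic.adelicUnitaryGroup (L : Type) V.Hm),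
        ∀ m₀ ∈ satLevelOf V (K₁ ⊓ conjLevel K' (k : finAdelic (↥(maximalRealSubfield L)) L (IsCMField.complexConj L) 3 V.Hm)⁻¹),
        ((quotU V).rTranslate₂ G₃ (regimeEquivT V hV
              ((cmAdelicProdEquiv (L : Type) 3 V.Hm).symm (1, (k : finAdelic (↥(maximalRealSubfield L)) L (IsCMField.complexConj L) 3 V.Hm)⁻¹))) :
            (quotU V).G → (Fin 2 → ℂ)) (regimeEquivT V hV (g₀ * m₀)) =
          ((quotU V).rTranslate₂ G₃ (regimeEquivT V hV
              ((cmAdelicProdEquiv (L : Type) 3 V.Hm).symm (1, (k : finAdelic (↥(maximalRealSubfield L)) L (IsCMField.complexConj L) 3 V.Hm)⁻¹))) :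
            (quotU V).G → (Fin 2 → ℂ)) (regimeEquivT V hV g₀)) ∧
      (∀ g₀ : ↥(Literature.NumberTheory.Automorphic.adelicUnitaryGroup (L : Type) V.Hm),
        ∀ m₀ ∈ satLevelOf V (K₁ ⊓ conjLevel K' (k : finAdelic (↥(maximalRealSubfield L)) L (IsCMField.complexConj L) 3 V.Hm)⁻¹),
        ((quotU V).rTranslate₂ G₄ (regimeEquivT V hV
              ((cmAdelicProdEquiv (L : Type) 3 V.Hm).symm (1, (k : finAdelic (↥(maximalRealSubfield L)) L (IsCMField.complexConj L) 3 V.Hm)⁻¹))) :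
            (quotU V).G → (Fin 2 → ℂ)) (regimeEquivT V hV (g₀ * m₀)) =
          ((quotU V).rTranslate₂ G₄ (regimeEquivT V hV
              ((cmAdelicProdEquiv (L : Type) 3 V.Hm).symm (1, (k : finAdelic (↥(maximalRealSubfield L)) L (IsCMField.complexConj L) 3 V.Hm)⁻¹))) :
            (quotU V).G → (Fin 2 → ℂ)) (regimeEquivT V hV g₀)) := by
  -- ### data of the principal piece (`M₁ = M_{K₁}`, `M' = M_{K₁ ∩ K'}`, `x₁ = [1]`, `e = regimeEquivT`)
  have hle : cmSplitLevel (L : Type) 3 V.Hm (K₁ ⊓ K') ≤ cmSplitLevel (L : Type) 3 V.Hm K₁ :=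
    splitLevel_mono (cmAdelicProdEquiv (L : Type) 3 V.Hm).toMulEquiv inf_le_left
  have hM₁o : IsOpen ((cmSplitLevel (L : Type) 3 V.Hm K₁ : Subgroup ↥(Literature.NumberTheory.Automorphic.adelicUnitaryGroup (L : Type) V.Hm)) : Set ↥(Literature.NumberTheory.Automorphic.adelicUnitaryGroup (L : Type) V.Hm)) :=
    isOpen_cmSplitLevel (L : Type) 3 V.Hm K₁ hK₁o
  have hM'o : IsOpen ((cmSplitLevel (L : Type) 3 V.Hm (K₁ ⊓ K') : Subgroup ↥(Literature.NumberTheory.Automorphic.adelicUnitaryGroup (L : Type) V.Hm)) : Set ↥(Literature.NumberTheory.Automorphic.adelicUnitaryGroup (L : Type) V.Hm)) :=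
    isOpen_cmSplitLevel (L : Type) 3 V.Hm _ (isOpen_coe_subgroup_inf hK₁o hK'o)
  have hπ₁c : Continuous (cmSplitProj (L : Type) 3 V.Hm K₁) := continuous_cmSplitProj (L : Type) 3 V.Hm K₁
  haveI : CompactSpace (↥(Literature.NumberTheory.Automorphic.adelicUnitaryGroup (L : Type) V.Hm) ⧸ adelicUnitaryRat (L : Type) V.Hm) :=
    Godement.compactSpace_adelicUnitaryQuot (L : Type) V.Hm (hanis_of_isAnisotropic hV)
  haveI hcpt : ∀ k : cmSplitLevel (L : Type) 3 V.Hm K₁,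
      CompactSpace (arch (↥(maximalRealSubfield L)) L (IsCMField.complexConj L) 3 V.Hm ⧸
        pieceLattice (conjLevel (cmSplitLevel (L : Type) 3 V.Hm (K₁ ⊓ K')) (k : ↥(Literature.NumberTheory.Automorphic.adelicUnitaryGroup (L : Type) V.Hm))⁻¹) (adelicUnitaryRat (L : Type) V.Hm)
          ((cmSplitProj (L : Type) 3 V.Hm K₁).comp (Subgroup.inclusion (conjLevel_le _ _ hle k)))
          (cmPrincipalPoint (L : Type) 3 V.Hm)) :=
    fun k => compactSpace_quotient_pieceLattice_conjLevel_inv _ (adelicUnitaryRat (L : Type) V.Hm) _ _ hle hM'o hπ₁c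
      (surjective_splitProj_comp_inclusion (cmAdelicProdEquiv (L : Type) 3 V.Hm).toMulEquiv inf_le_left)
      (cmPrincipalPoint (L : Type) 3 V.Hm) k
  -- ### representatives of `K₁ / (K₁ ∩ K')` placed in `{1} × K₁`
  obtain ⟨S, hS, hgen⟩ :=
    exists_finset_splitLevel_inf_eq_mul_of_isCompact (cmAdelicProdEquiv (L : Type) 3 V.Hm).toMulEquiv K₁ K' hK₁c hK₁o hK'o
  -- ### the global vector read back on `U(V)(𝔸) ⧸ U(V)(L⁺)` and the meeting lemma
  have h0 : ⟪pieceLiftLp ℂ (cmSplitLevel (L : Type) 3 V.Hm K₁) (adelicUnitaryRat (L : Type) V.Hm) (cmSplitProj (L : Type) 3 V.Hm K₁)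
      (cmPrincipalPoint (L : Type) 3 V.Hm) ((quotU V).pullbackν (adelicUnitaryRat (L : Type) V.Hm) (regimeEquivT V hV)
        (regimeEquivT_mem_Γ_iff V hV)) 2 hM₁o hπ₁c f,
      ((quotU V).transportL2 (adelicUnitaryRat (L : Type) V.Hm) (regimeEquivT V hV) (regimeEquivT_mem_Γ_iff V hV)).symm
        ((quotU V).realise ((quotU V).wedge₂ G₃ G₄))⟫_ℂ ≠ 0 := by
    rwa [(quotU V).inner_pieceEmb_left_eq_inner_pieceLiftLp (adelicUnitaryRat (L : Type) V.Hm) (regimeEquivT V hV)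
      (regimeEquivT_mem_Γ_iff V hV) _ _ (cmPrincipalPoint (L : Type) 3 V.Hm) hM₁o hπ₁c f _] at hne
  obtain ⟨k, hkS, hk⟩ := exists_mem_inner_translateLp_ne_zero (cmSplitLevel (L : Type) 3 V.Hm K₁) (adelicUnitaryRat (L : Type) V.Hm)
    (cmSplitProj (L : Type) 3 V.Hm K₁) (cmPrincipalPoint (L : Type) 3 V.Hm)
    ((quotU V).pullbackν (adelicUnitaryRat (L : Type) V.Hm) (regimeEquivT V hV) (regimeEquivT_mem_Γ_iff V hV))
    (cmSplitLevel (L : Type) 3 V.Hm (K₁ ⊓ K')) hle hM₁o hπ₁c hM'o S hS hgen f _ h0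
  -- ### the finite part `k_f ∈ K₁` of the representative; `k = e₀⁻¹(1, k_f)`
  have hkf₁ : (cmAdelicProdEquiv (L : Type) 3 V.Hm (k : ↥(Literature.NumberTheory.Automorphic.adelicUnitaryGroup (L : Type) V.Hm))).2 ∈ K₁ := (mem_cmSplitLevel_iff (L : Type) 3 V.Hm K₁ _).1 k.2
  have hk1 : (cmAdelicProdEquiv (L : Type) 3 V.Hm (k : ↥(Literature.NumberTheory.Automorphic.adelicUnitaryGroup (L : Type) V.Hm))).1 = 1 := hS k hkS
  have hk_eq : (k : ↥(Literature.NumberTheory.Automorphic.adelicUnitaryGroup (L : Type) V.Hm)) = (cmAdelicProdEquiv (L : Type) 3 V.Hm).symm (1, (cmAdelicProdEquiv (L : Type) 3 V.Hm (k : ↥(Literature.NumberTheory.Automorphic.adelicUnitaryGroup (L : Type) V.Hm))).2) := by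
    apply (cmAdelicProdEquiv (L : Type) 3 V.Hm).injective
    rw [ContinuousMulEquiv.apply_symm_apply]
    exact Prod.ext hk1 rfl
  have hk_inv : (k : ↥(Literature.NumberTheory.Automorphic.adelicUnitaryGroup (L : Type) V.Hm))⁻¹ = (cmAdelicProdEquiv (L : Type) 3 V.Hm).symm (1, ((cmAdelicProdEquiv (L : Type) 3 V.Hm (k : ↥(Literature.NumberTheory.Automorphic.adelicUnitaryGroup (L : Type) V.Hm))).2)⁻¹) := by
    conv_lhs => rw [hk_eq]
    rw [← map_inv, Prod.inv_mk, inv_one]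
  -- ### the sub-level `k⁻¹ M' k` is the split level of `K₁ ∩ k_f⁻¹ K' k_f`: re-level the pulled-back class
  have hL := conjLevel_cmSplitLevel_inf_eq V K₁ K' (k : ↥(Literature.NumberTheory.Automorphic.adelicUnitaryGroup (L : Type) V.Hm)) hkf₁
  have hle'' : cmSplitLevel (L : Type) 3 V.Hm (K₁ ⊓ conjLevel K' ((cmAdelicProdEquiv (L : Type) 3 V.Hm (k : ↥(Literature.NumberTheory.Automorphic.adelicUnitaryGroup (L : Type) V.Hm))).2)⁻¹) ≤
      cmSplitLevel (L : Type) 3 V.Hm K₁ :=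
    splitLevel_mono (cmAdelicProdEquiv (L : Type) 3 V.Hm).toMulEquiv inf_le_left
  have hL''o : IsOpen ((cmSplitLevel (L : Type) 3 V.Hm (K₁ ⊓ conjLevel K' ((cmAdelicProdEquiv (L : Type) 3 V.Hm (k : ↥(Literature.NumberTheory.Automorphic.adelicUnitaryGroup (L : Type) V.Hm))).2)⁻¹) :
      Subgroup ↥(Literature.NumberTheory.Automorphic.adelicUnitaryGroup (L : Type) V.Hm)) : Set ↥(Literature.NumberTheory.Automorphic.adelicUnitaryGroup (L : Type) V.Hm)) :=
    isOpen_cmSplitLevel (L : Type) 3 V.Hm _ (isOpen_coe_subgroup_inf hK₁o (isOpen_conjLevel K' hK'o _))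
  haveI : CompactSpace (arch (↥(maximalRealSubfield L)) L (IsCMField.complexConj L) 3 V.Hm ⧸
      pieceLattice (cmSplitLevel (L : Type) 3 V.Hm (K₁ ⊓ conjLevel K' ((cmAdelicProdEquiv (L : Type) 3 V.Hm (k : ↥(Literature.NumberTheory.Automorphic.adelicUnitaryGroup (L : Type) V.Hm))).2)⁻¹))
        (adelicUnitaryRat (L : Type) V.Hm) ((cmSplitProj (L : Type) 3 V.Hm K₁).comp (Subgroup.inclusion hle''))
        (cmPrincipalPoint (L : Type) 3 V.Hm)) :=
    hK ⟨_, hkf₁⟩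
  have hcongr := pieceLiftLp_levelCover_congr ℂ (cmSplitLevel (L : Type) 3 V.Hm K₁) (adelicUnitaryRat (L : Type) V.Hm)
    (cmSplitProj (L : Type) 3 V.Hm K₁) (cmPrincipalPoint (L : Type) 3 V.Hm)
    ((quotU V).pullbackν (adelicUnitaryRat (L : Type) V.Hm) (regimeEquivT V hV) (regimeEquivT_mem_Γ_iff V hV)) 2
    (conjLevel (cmSplitLevel (L : Type) 3 V.Hm (K₁ ⊓ K')) (k : ↥(Literature.NumberTheory.Automorphic.adelicUnitaryGroup (L : Type) V.Hm))⁻¹) (conjLevel_le _ _ hle k)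
    (cmSplitLevel (L : Type) 3 V.Hm (K₁ ⊓ conjLevel K' ((cmAdelicProdEquiv (L : Type) 3 V.Hm (k : ↥(Literature.NumberTheory.Automorphic.adelicUnitaryGroup (L : Type) V.Hm))).2)⁻¹)) hle'' hπ₁c
    (isOpen_conjLevel _ hM'o _) hL''o (by rw [hL]) f
  rw [← hcongr] at hk
  -- ### transport to `Q.H`: the translate of the realised wedge is the realised wedge of the translates (§ 1)
  have key : (quotU V).transportL2 (adelicUnitaryRat (L : Type) V.Hm) (regimeEquivT V hV) (regimeEquivT_mem_Γ_iff V hV)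
      (translateLp ℂ ((quotU V).pullbackν (adelicUnitaryRat (L : Type) V.Hm) (regimeEquivT V hV) (regimeEquivT_mem_Γ_iff V hV)) 2
        (k : ↥(Literature.NumberTheory.Automorphic.adelicUnitaryGroup (L : Type) V.Hm))⁻¹
        (((quotU V).transportL2 (adelicUnitaryRat (L : Type) V.Hm) (regimeEquivT V hV) (regimeEquivT_mem_Γ_iff V hV)).symm
          ((quotU V).realise ((quotU V).wedge₂ G₃ G₄)))) =
      (quotU V).realise ((quotU V).wedge₂
        ((quotU V).rTranslate₂ G₃ (regimeEquivT V hV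
          ((cmAdelicProdEquiv (L : Type) 3 V.Hm).symm (1, ((cmAdelicProdEquiv (L : Type) 3 V.Hm (k : ↥(Literature.NumberTheory.Automorphic.adelicUnitaryGroup (L : Type) V.Hm))).2)⁻¹))))
        ((quotU V).rTranslate₂ G₄ (regimeEquivT V hV
          ((cmAdelicProdEquiv (L : Type) 3 V.Hm).symm (1, ((cmAdelicProdEquiv (L : Type) 3 V.Hm (k : ↥(Literature.NumberTheory.Automorphic.adelicUnitaryGroup (L : Type) V.Hm))).2)⁻¹))))) := by
    rw [(quotU V).transportL2_translateLp, LinearIsometryEquiv.apply_symm_apply, hk_inv, QuotientModel.R_realise_wedge₂]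
  refine ⟨⟨_, hkf₁⟩, ?_, ?_, ?_⟩
  · rw [QuotientModel.pieceEmb_apply, ← key, QuotientModel.inner_transportL2]
    exact hk
  · exact sat_rTranslate₂ V hV K' _ ((cmAdelicProdEquiv (L : Type) 3 V.Hm).symm (1, _))
      (by rw [ContinuousMulEquiv.apply_symm_apply]; exact inf_le_right) G₃ h₃
  · exact sat_rTranslate₂ V hV K' _ ((cmAdelicProdEquiv (L : Type) 3 V.Hm).symm (1, _))
      (by rw [ContinuousMulEquiv.apply_symm_apply]; exact inf_le_right) G₄ h₄

end Model

end HodgeCM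

end
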